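import Summits.QuantumAdvantage.QuantumAdvantage.Theorems.CubicForrelationNearExactIsExactTwelveZ512Div8Dead
import Summits.QuantumAdvantage.QuantumAdvantage.Theorems.CubicForrelationNearExactIsExactTwelveZ768WindowDead
import Summits.QuantumAdvantage.QuantumAdvantage.Theorems.CubicForrelationNearExactIsExactTwelveLevelSixEightPrep768
import Summits.QuantumAdvantage.QuantumAdvantage.Theorems.CubicForrelationNearExactIsExactTwelveZ512OffDiv8

/-!
# Crux `CubicForrelation.NearExactIsExact` (stmt-QuantumAdvantage-14043) — n = 12, the OPEN window `57/64 < Φ < 29/32`, both sides at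
  level `≥ 6`: the RESIDUAL configuration after gen 26 (packaging)

Certificate seat `b2b-cforr-cert` (gen 26).  HONEST FRAMING: packaging lemmas (standard axioms) that state, for the successor, exactly what is
left of the level-`≥ 6` × level-`≥ 6` branch of the open window after …TwelveZ768WindowDead (`#Z = 768` dead, every side a 9-flat),
…TwelveZ512Div8Dead (main branch dead) and …TwelveZ512OffDiv8 (off-flat energy `≤ 127` ⇒ `8 ∣ e` off the flat).  NO new value of `θ₁₂`;
NOT summit progress.

For cubic `f, g` on 12 bits with `W_g = 64u''`, `W_f = 64wf`, `57/64 < Φ < 1`, `e = u'' − (−1)^f`, `Z = {u'' even}`, `σ = e mod 4` on `Z`,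
`L = {x ∈ Z : (e − σ)/4 odd}`:
* `tzf_levelSix_window_residual` (packaging with gen 26's `tzw_levelSix_window_Z512`): for cubic `f, g` at level `≥ 6` on both sides with
  `57/64 < Φ < 1`, the even set of `u''` is a 9-flat `x_Z ⊕ V₀` AND the side is off the main branch: some point off `Z` has `8 ∤ e`, or some
  point of `Z` has `e ≢ ±1 (mod 8)`.
* `tzf_levelSix_window_residual_L` (sharper, with gen 23's `tw23_levelSix_eight_prep768`): in the second alternative one may assume `8 ∣ e`
  off `Z` AND `#L ≥ 32` for `L = {x ∈ Z : (e − σ)/4 odd}` (if `8 ∣ e` off `Z` and `#L ≤ 31` then `λ` is even on `Z`, i.e. the main branch).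
* `tzf_levelSix_window_residual2` (with gen 26's `tzf_off_div8_le127`): the dichotomy by off-flat energy — EITHER the off-flat energy is
  `≥ 128` and some off-flat point has `8 ∤ e` (then `Σ_Z(e² − 1) ≤ 255`), OR the off-flat energy is `≤ 127`, `8 ∣ e` off `Z` and `#L ≥ 32`
  (then `Σ_Z(e² − 1) ≥ 256`).

So per side: EITHER the off-flat energy is `≥ 128` with a non-8-divisible off-flat point (then `Σ_Z(e² − 1) ≤ 255`), OR it is `≤ 127`, `8 ∣ e`
off `Z` and `#L ≥ 32` (then `Σ_Z(e² − 1) ≥ 256`; gen 23's (δ₀) pattern with slack — HOME/b2b-cforr-cert-g26/PROOF-N12-WINDOW-L6.md §3).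

References: MacWilliams–Sloane (1977) Ch. 13–15; R. O'Donnell (2014) §3.3.  Axioms: the standard three.
-/

set_option linter.dupNamespace false -- D-0017: single-problem summit ⇒ `QuantumAdvantage.QuantumAdvantage` by design

noncomputable section

namespace Summit.QuantumAdvantage.QuantumAdvantage.Theorems.CubicForrelation.NearExactIsExact

open Finset
open Literature.Computability.QuantumComplexity
open Literature.Computability.QuantumComplexity.BuzetChailloux (bxor zeroVec bxor_bxor_cancel_left bxor_zeroVec zeroVec_bxor bxor_comm
  bxor_self)
open Literature.Computability.QuantumComplexity.DerivativeWalsh (W)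

/-- **The residual configuration of the level-`≥ 6` × level-`≥ 6` branch on the open window** (packaging): cubic `f, g` on 12 bits,
`W_g = 64u''`, `W_f = 64wf`, `57/64 < Φ(f,g) < 1`.  Then `Z = {u'' even}` is a 9-flat `x_Z ⊕ V₀` (`tzw_levelSix_window_Z512`,
`mw_flat_of_minweight`) and the residual `e = u'' − (−1)^f` is OFF the main branch: `8 ∤ e(y)` at some `y ∉ Z`, or `e(x) ≢ ±1 (mod 8)` at some
`x ∈ Z` (`tzf_Z512_div8_false`).  Finite-slice statement, NOT summit progress. [this work] -/
theorem tzf_levelSix_window_residual (f g : (Fin (6 + 6) → Bool) → Bool) (hf : IsDegLeFun 3 f) (hg : IsDegLeFun 3 g)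
    (u'' : (Fin (6 + 6) → Bool) → ℤ) (hu'' : ∀ x, W (fun y => signOf (g y)) x = (2 : ℝ) ^ 6 * (u'' x : ℝ))
    (wf : (Fin (6 + 6) → Bool) → ℤ) (hwf : ∀ y, W (fun x => signOf (f x)) y = (2 : ℝ) ^ 6 * (wf y : ℝ))
    (hlo : (57 / 64 : ℝ) < forrelation f g) (hhi : forrelation f g < 1) :
    ∃ (V₀ : Finset (Fin (6 + 6) → Bool)) (xZ : Fin (6 + 6) → Bool), zeroVec ∈ V₀ ∧ (∀ a ∈ V₀, ∀ b ∈ V₀, bxor a b ∈ V₀) ∧ #V₀ = 512 ∧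
      (univ.filter fun x : Fin (6 + 6) → Bool => ¬ Odd (u'' x)) = V₀.image (bxor xZ) ∧
      ((∃ y, y ∉ (univ.filter fun x : Fin (6 + 6) → Bool => ¬ Odd (u'' x)) ∧ ¬ (8 : ℤ) ∣ u'' y - sZ (f y)) ∨
       (∃ x ∈ (univ.filter fun x : Fin (6 + 6) → Bool => ¬ Odd (u'' x)),
          ¬ (8 : ℤ) ∣ u'' x - sZ (f x) - 1 ∧ ¬ (8 : ℤ) ∣ u'' x - sZ (f x) + 1)) := by
  classical
  have h512 := tzw_levelSix_window_Z512 f g hf hg u'' hu'' wf hwf hlo hhi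
  have hp : IsDegLeFun 3 (fun x => decide (Odd (u'' x))) :=
    stub_walshTower stub_axParity (6 + 6) 6 3 g u'' hg hu'' (by intro k hk hkn; omega)
  have hp' : IsDegLeFun (2 + 1) (fun x => decide (Odd (u'' x)) ^^ true) := tb_isDegLeFun_xor_const hp true
  have hfilt : (univ.filter fun x : Fin (6 + 6) → Bool => (decide (Odd (u'' x)) ^^ true) = true) =
      (univ.filter fun x : Fin (6 + 6) → Bool => ¬ Odd (u'' x)) :=
    filter_congr fun x _ => by simp
  have hmw := mw_flat_of_minweight 2 (fun x => decide (Odd (u'' x)) ^^ true) hp' (by rw [hfilt, h512]; norm_num)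
  rw [hfilt] at hmw
  obtain ⟨h0, hadd, hcardV, hcoset⟩ := hmw
  set V₀ := univ.filter (fun a : Fin (6 + 6) → Bool => ∀ x,
    (decide (Odd (u'' (bxor x a))) ^^ true) = (decide (Odd (u'' x)) ^^ true)) with hV₀
  obtain ⟨xZ, hxZ⟩ : (univ.filter fun x : Fin (6 + 6) → Bool => ¬ Odd (u'' x)).Nonempty := card_pos.1 (by rw [h512]; norm_num)
  have hS : (univ.filter fun x : Fin (6 + 6) → Bool => ¬ Odd (u'' x)) = V₀.image (bxor xZ) :=
    hcoset xZ (by have h := (mem_filter.1 hxZ).2; simpa using h)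
  rw [h512] at hcardV
  refine ⟨V₀, xZ, h0, hadd, hcardV, hS, ?_⟩
  by_contra hnone
  push Not at hnone
  obtain ⟨hoff, hon⟩ := hnone
  refine tzf_Z512_div8_false f g hf hg u'' hu'' wf hwf V₀ xZ h0 hadd hcardV hS hoff (fun x hx => ?_) hlo hhi
  by_cases h1 : (8 : ℤ) ∣ u'' x - sZ (f x) - 1
  · exact Or.inl h1
  · exact Or.inr (hon x hx h1)

/-- **Sharper residual**: cubic `f, g` on 12 bits at level `≥ 6` on both sides with `57/64 < Φ < 1`.  Then `Z = {u'' even}` is a 9-flat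
`x_Z ⊕ V₀` and EITHER some point off `Z` has `8 ∤ e` OR (`8 ∣ e` off `Z` and the set `L = {x ∈ Z : (e − σ)/4 odd}`, `σ = e mod 4`, has at
least `32` points — so `Σ_Z (e² − 1) ≥ 256` and the off-`Z` energy is `≤ 127`).  (`tw23_levelSix_eight_prep768`: `8 ∣ e` off `Z` and `#L ≤ 31`
force `λ` even on `Z`, the main branch, dead by `tzf_Z512_div8_false`.)  Finite-slice statement, NOT summit progress. [this work] -/
theorem tzf_levelSix_window_residual_L (f g : (Fin (6 + 6) → Bool) → Bool) (hf : IsDegLeFun 3 f) (hg : IsDegLeFun 3 g)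
    (u'' : (Fin (6 + 6) → Bool) → ℤ) (hu'' : ∀ x, W (fun y => signOf (g y)) x = (2 : ℝ) ^ 6 * (u'' x : ℝ))
    (wf : (Fin (6 + 6) → Bool) → ℤ) (hwf : ∀ y, W (fun x => signOf (f x)) y = (2 : ℝ) ^ 6 * (wf y : ℝ))
    (hlo : (57 / 64 : ℝ) < forrelation f g) (hhi : forrelation f g < 1) :
    ∃ (V₀ : Finset (Fin (6 + 6) → Bool)) (xZ : Fin (6 + 6) → Bool), zeroVec ∈ V₀ ∧ (∀ a ∈ V₀, ∀ b ∈ V₀, bxor a b ∈ V₀) ∧ #V₀ = 512 ∧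
      (univ.filter fun x : Fin (6 + 6) → Bool => ¬ Odd (u'' x)) = V₀.image (bxor xZ) ∧
      ((∃ y, y ∉ (univ.filter fun x : Fin (6 + 6) → Bool => ¬ Odd (u'' x)) ∧ ¬ (8 : ℤ) ∣ u'' y - sZ (f y)) ∨
       ((∀ y, y ∉ (univ.filter fun x : Fin (6 + 6) → Bool => ¬ Odd (u'' x)) → (8 : ℤ) ∣ u'' y - sZ (f y)) ∧
        32 ≤ #((univ.filter fun x : Fin (6 + 6) → Bool => ¬ Odd (u'' x)).filter fun x =>
          Odd ((u'' x - sZ (f x) - sZ (decide ((u'' x - sZ (f x)) % 4 = 3))) / 4)))) := by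
  classical
  obtain ⟨V₀, xZ, h0, hadd, hcardV, hS, hres⟩ := tzf_levelSix_window_residual f g hf hg u'' hu'' wf hwf hlo hhi
  refine ⟨V₀, xZ, h0, hadd, hcardV, hS, ?_⟩
  by_cases hoff8 : ∀ y, y ∉ (univ.filter fun x : Fin (6 + 6) → Bool => ¬ Odd (u'' x)) → (8 : ℤ) ∣ u'' y - sZ (f y)
  · right
    refine ⟨hoff8, ?_⟩
    by_contra hlt
    push Not at hlt
    have hL31 : #((univ.filter fun x : Fin (6 + 6) → Bool => ¬ Odd (u'' x)).filter fun x =>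
        Odd ((u'' x - sZ (f x) - sZ (decide ((u'' x - sZ (f x)) % 4 = 3))) / 4)) ≤ 31 := by omega
    obtain ⟨hLeven, -⟩ := tw23_levelSix_eight_prep768 (∑ x, (u'' x - sZ (f x)) ^ 2 : ℤ) f g hf hg u'' hu'' le_rfl
      V₀ xZ h0 hadd hcardV hS hoff8 hL31
    -- `λ` even on `Z` ⇒ `e ≡ σ (mod 8)` on `Z`: the main branch
    refine tzf_Z512_div8_false f g hf hg u'' hu'' wf hwf V₀ xZ h0 hadd hcardV hS hoff8 (fun x hx => ?_) hlo hhi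
    obtain ⟨k, hk⟩ := hLeven x hx
    have hσ : sZ (decide ((u'' x - sZ (f x)) % 4 = 3)) = 1 ∨ sZ (decide ((u'' x - sZ (f x)) % 4 = 3)) = -1 := tp_sZ_cases _
    -- `e` is odd on `Z`, so `4 ∣ e − σ`
    have hxZ' : ¬ Odd (u'' x) := (mem_filter.1 hx).2
    have heodd : Odd (u'' x - sZ (f x)) := by
      have hev := Int.not_odd_iff_even.1 hxZ'
      rcases tp_sZ_cases (f x) with hs | hs <;> rw [hs]
      · exact Int.odd_sub.2 (iff_of_false (Int.not_odd_iff_even.2 hev) (by decide))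
      · exact Int.odd_sub.2 (iff_of_false (Int.not_odd_iff_even.2 hev) (by decide))
    have h4 : (4 : ℤ) ∣ u'' x - sZ (f x) - sZ (decide ((u'' x - sZ (f x)) % 4 = 3)) := by
      have ho := Int.odd_iff.1 heodd
      by_cases h3 : (u'' x - sZ (f x)) % 4 = 3
      · have : sZ (decide ((u'' x - sZ (f x)) % 4 = 3)) = -1 := by rw [decide_eq_true h3]; simp [sZ]
        rw [this]; omega
      · have : sZ (decide ((u'' x - sZ (f x)) % 4 = 3)) = 1 := by rw [decide_eq_false h3]; simp [sZ]
        rw [this]; omega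
    have h8 : (8 : ℤ) ∣ u'' x - sZ (f x) - sZ (decide ((u'' x - sZ (f x)) % 4 = 3)) := by
      obtain ⟨q, hq⟩ := h4
      rw [hq] at hk ⊢
      have hq4 : (4 * q) / 4 = q := by omega
      rw [hq4] at hk
      exact ⟨k, by omega⟩
    rcases hσ with h1 | h1
    · left; rwa [h1] at h8
    · right; rw [h1] at h8; simpa using h8
  · left
    push Not at hoff8
    exact hoff8

/-- **The residual dichotomy by off-flat energy** (packaging): cubic `f, g` on 12 bits at level `≥ 6` on both sides, `57/64 < Φ < 1`,
`e = u'' − (−1)^f`, `Z = {u'' even}` (a 9-flat `x_Z ⊕ V₀`), `L = {x ∈ Z : (e − σ)/4 odd}`.  Then EITHER `Σ_{Z^c} e² ≥ 128` and some point off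
`Z` has `8 ∤ e`, OR `Σ_{Z^c} e² ≤ 127`, `8 ∣ e` off `Z` and `#L ≥ 32`.  (`tzf_off_div8_le127` + `tzf_levelSix_window_residual_L`.)
Finite-slice statement, NOT summit progress. [this work] -/
theorem tzf_levelSix_window_residual2 (f g : (Fin (6 + 6) → Bool) → Bool) (hf : IsDegLeFun 3 f) (hg : IsDegLeFun 3 g)
    (u'' : (Fin (6 + 6) → Bool) → ℤ) (hu'' : ∀ x, W (fun y => signOf (g y)) x = (2 : ℝ) ^ 6 * (u'' x : ℝ))
    (wf : (Fin (6 + 6) → Bool) → ℤ) (hwf : ∀ y, W (fun x => signOf (f x)) y = (2 : ℝ) ^ 6 * (wf y : ℝ))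
    (hlo : (57 / 64 : ℝ) < forrelation f g) (hhi : forrelation f g < 1) :
    ∃ (V₀ : Finset (Fin (6 + 6) → Bool)) (xZ : Fin (6 + 6) → Bool), zeroVec ∈ V₀ ∧ (∀ a ∈ V₀, ∀ b ∈ V₀, bxor a b ∈ V₀) ∧ #V₀ = 512 ∧
      (univ.filter fun x : Fin (6 + 6) → Bool => ¬ Odd (u'' x)) = V₀.image (bxor xZ) ∧
      ((128 ≤ ∑ x ∈ univ.filter (fun x => x ∉ univ.filter (fun x : Fin (6 + 6) → Bool => ¬ Odd (u'' x))), (u'' x - sZ (f x)) ^ 2 ∧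
        ∃ y, y ∉ (univ.filter fun x : Fin (6 + 6) → Bool => ¬ Odd (u'' x)) ∧ ¬ (8 : ℤ) ∣ u'' y - sZ (f y)) ∨
       (∑ x ∈ univ.filter (fun x => x ∉ univ.filter (fun x : Fin (6 + 6) → Bool => ¬ Odd (u'' x))), (u'' x - sZ (f x)) ^ 2 ≤ 127 ∧
        (∀ y, y ∉ (univ.filter fun x : Fin (6 + 6) → Bool => ¬ Odd (u'' x)) → (8 : ℤ) ∣ u'' y - sZ (f y)) ∧
        32 ≤ #((univ.filter fun x : Fin (6 + 6) → Bool => ¬ Odd (u'' x)).filter fun x =>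
          Odd ((u'' x - sZ (f x) - sZ (decide ((u'' x - sZ (f x)) % 4 = 3))) / 4)))) := by
  classical
  obtain ⟨V₀, xZ, h0, hadd, hcardV, hS, hres⟩ := tzf_levelSix_window_residual_L f g hf hg u'' hu'' wf hwf hlo hhi
  refine ⟨V₀, xZ, h0, hadd, hcardV, hS, ?_⟩
  by_cases h127 : ∑ x ∈ univ.filter (fun x => x ∉ univ.filter (fun x : Fin (6 + 6) → Bool => ¬ Odd (u'' x))),
      (u'' x - sZ (f x)) ^ 2 ≤ 127
  · right
    have h8 := tzf_off_div8_le127 f g hf hg u'' hu'' V₀ xZ h0 hadd hcardV hS h127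
    rcases hres with ⟨y, hy, hy8⟩ | ⟨-, hL⟩
    · exact absurd (h8 y hy) hy8
    · exact ⟨h127, h8, hL⟩
  · left
    push Not at h127
    refine ⟨by omega, ?_⟩
    rcases hres with h | ⟨h8, hL⟩
    · exact h
    · -- `8 ∣ e` off `Z` and `#L ≥ 32`: then `Σ_Z (e² − 1) ≥ 256`, so the off-flat energy is `≤ 127` — contradiction
      exfalso
      obtain ⟨hBR, heodd, hoffle⟩ := tzw_budget_split f g u'' hu''
      set Z := univ.filter (fun x : Fin (6 + 6) → Bool => ¬ Odd (u'' x)) with hZdef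
      set e : (Fin (6 + 6) → Bool) → ℤ := fun x => u'' x - sZ (f x) with hedef
      have hB : (∑ x, e x ^ 2 : ℤ) ≤ 895 := by
        have h' : ((∑ x, e x ^ 2 : ℤ) : ℝ) < 896 := by rw [hBR]; linarith
        have h'' : (∑ x, e x ^ 2 : ℤ) < 896 := by exact_mod_cast h'
        omega
      have hZcard : #Z = 512 := by rw [hS, card_image_of_injective _ (iw_bxor_injective xZ), hcardV]
      -- points of `L` cost `≥ 9`, the others `≥ 1`
      set L := Z.filter (fun x => Odd ((e x - sZ (decide (e x % 4 = 3))) / 4)) with hLdef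
      have hLsub : L ⊆ Z := filter_subset _ _
      have hcostL : ∀ x ∈ L, (9 : ℤ) ≤ e x ^ 2 := by
        intro x hx
        have hx' := mem_filter.1 hx
        have ho := Int.odd_iff.1 (heodd x hx'.1)
        change e x % 2 = 1 at ho
        have hlam := Int.odd_iff.1 hx'.2
        -- `e ≡ σ + 4 (mod 8)` with `σ = e mod 4`: so `|e| ≥ 3`
        have h3 : e x ≤ -3 ∨ 3 ≤ e x := by
          by_cases hm : e x % 4 = 3
          · have hs : sZ (decide (e x % 4 = 3)) = -1 := by rw [decide_eq_true hm]; simp [sZ]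
            rw [hs] at hlam; omega
          · have hs : sZ (decide (e x % 4 = 3)) = 1 := by rw [decide_eq_false hm]; simp [sZ]
            rw [hs] at hlam; omega
        have := tp_sq_ge (k := 3) (by norm_num) h3
        linarith
      have hcost1 : ∀ x ∈ Z, (1 : ℤ) ≤ e x ^ 2 := by
        intro x hx
        have ho := Int.odd_iff.1 (heodd x hx)
        change e x % 2 = 1 at ho
        have : e x ≤ -1 ∨ 1 ≤ e x := by omega
        have := tp_sq_ge (k := 1) (by norm_num) this
        linarith
      have hZsum : (512 : ℤ) + 256 ≤ ∑ x ∈ Z, e x ^ 2 := by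
        have hsplitZ : ∑ x ∈ Z, e x ^ 2 = ∑ x ∈ L, e x ^ 2 + ∑ x ∈ Z.filter (fun x => x ∉ L), e x ^ 2 := by
          rw [← sum_filter_add_sum_filter_not Z (fun x => x ∈ L)]
          congr 1
          exact sum_congr (by ext x; simp only [mem_filter]; exact ⟨fun h => h.2, fun h => ⟨hLsub h, h⟩⟩) fun _ _ => rfl
        have h1 : (9 : ℤ) * #L ≤ ∑ x ∈ L, e x ^ 2 := by
          have := sum_le_sum hcostL
          rw [sum_const, nsmul_eq_mul] at this
          linarith
        have h2 : (1 : ℤ) * #(Z.filter fun x => x ∉ L) ≤ ∑ x ∈ Z.filter (fun x => x ∉ L), e x ^ 2 := by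
          have hc : ∀ x ∈ Z.filter (fun x => x ∉ L), (1 : ℤ) ≤ e x ^ 2 := fun x hx => hcost1 x (mem_filter.1 hx).1
          have := sum_le_sum hc
          rw [sum_const, nsmul_eq_mul] at this
          linarith
        have h3 : #(Z.filter fun x => x ∉ L) + #L = #Z := by
          have := Finset.card_filter_add_card_filter_not (s := Z) (fun x => x ∉ L)
          have e2 : Z.filter (fun x => ¬ x ∉ L) = L := by
            ext x; simp only [mem_filter, not_not]; exact ⟨fun h => h.2, fun h => ⟨hLsub h, h⟩⟩
          rw [e2] at this
          exact this
        have h3' : (#(Z.filter fun x => x ∉ L) : ℤ) = 512 - #L := by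
          have h3z : (((#(Z.filter fun x => x ∉ L) + #L : ℕ)) : ℤ) = ((#Z : ℕ) : ℤ) := by rw [h3]
          rw [hZcard] at h3z
          push_cast at h3z
          linarith
        have hL' : (32 : ℤ) ≤ #L := by exact_mod_cast hL
        rw [hsplitZ]
        nlinarith
      have hsplit : (∑ x, e x ^ 2 : ℤ) = ∑ x ∈ Z, e x ^ 2 + ∑ x ∈ univ.filter (fun x => x ∉ Z), e x ^ 2 := by
        rw [← sum_filter_add_sum_filter_not univ (fun x => x ∈ Z)]
        congr 1
        exact sum_congr (by ext x; simp) fun _ _ => rfl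
      have : ∑ x ∈ univ.filter (fun x => x ∉ Z), e x ^ 2 ≤ 127 := by linarith
      exact absurd this (by simpa using h127)

end Summit.QuantumAdvantage.QuantumAdvantage.Theorems.CubicForrelation.NearExactIsExact

end
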